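import Mathlib.Tactic.Group
import Literature.AnabelianGeometry.SemiGraphs.TemperoidsResProofs
import Literature.AnabelianGeometry.EtaleTheta.CyclotomicEnvelope
import HarnessLib

/-!
# [SemiAnbd] Prop 3.2 consequence: a pseudo-action on `B^temp(Π)` by restriction functors IS an outer action

Mochizuki, *Semi-graphs of anabelioids*, Publ. RIMS **42** (2006), §3, Proposition 3.2 (p. 35): "the
natural map `Hom^out_cont(Π₁, Π₂) → Hom(B^temp(Π₂), B^temp(Π₁))` [continuous outer homomorphisms to
isomorphism classes of morphisms of temperoids] is bijective"; applied as in §5 Prop 5.2 (iv) /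
Def 5.1 (i) p. 62 to an ACTION. [cite: MochizukiSemiAnbd2006, Prop 3.2, p. 35]

PROOF-ONLY file (no definitions), step 1 of row T54-B-func (plan/GAP-LEDGER.md G-w4d053-1, L3-lead
α6: «d082 T54-B-func GO (∃-form, abstract binders, no ofReal)»).  GENERIC over a tempered topological
group `Π` (`hG : IsTempered Π`) and an index group `Π_A`: given continuous endomorphisms
`φ_a : Π → Π` (`a ∈ Π_A`) whose restriction functors `B^temp(φ_a)` form a PSEUDO-ACTION —
`B^temp(φ_{ab}) ≅ B^temp(φ_a) ⋙ B^temp(φ_b)` and `B^temp(φ_1) ≅ 𝟭` — Proposition 3.2's injectivity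
half (the tree's `BTemp.exists_conj_of_natTrans`, seat abc-iut-L3-t2/L3-d2 lineage) yields:

* `surjective_of_res_comp_iso_id` / `injective_of_res_comp_iso_id`: `B^temp(φ ∘ ψ) ≅ 𝟭` forces
  `φ ∘ ψ = conj(g)`, so `φ` is surjective and `ψ` injective;
* `bijective_of_resFamily`: every `φ_a` is BIJECTIVE, with inverse `φ_{a⁻¹} ∘ conj(g)` continuous;
* `exists_contMulAut_of_resFamily`: every `φ_a` underlies a bi-continuous automorphism `Φ_a ∈ Aut_top(Π)`
  (`EtaleTheta.contMulAut`);
* **`exists_outerAction_of_resFamily`**: there is a HOMOMORPHISM `ρ : Π_A →* Out(Π)`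
  (`EtaleTheta.TopOut`) with `ρ a = [Φ_a]`, `Φ_a = φ_a` pointwise — the outer action.

Consumed by the graph-level step (`ArithOuterActionOfGraphAction.lean`: `φ_a` = the homomorphism induced
by an automorphism of a semi-graph of anabelioids, Prop 3.6 (iv)).  Nothing here takes a side on
[IUTchIII] Cor 3.12; typed ≠ proved.
-/

namespace Literature.AnabelianGeometry.SemiGraphs

open CategoryTheory Literature.AnabelianGeometry.EtaleTheta

universe u w

section ResFamily

variable {G : Type u} [Group G] [TopologicalSpace G] [IsTopologicalGroup G]

/-- **Prop 3.2 consequence**: if `B^temp(φ ∘ ψ) ≅ 𝟭` (as functors `B^temp(Π) ⥤ B^temp(Π)`) for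
continuous endomorphisms `φ`, `ψ` of a tempered `Π`, then `φ ∘ ψ` is an inner automorphism: there is
`g` with `φ (ψ t) = g⁻¹ t g` for all `t`. [cite: MochizukiSemiAnbd2006, Prop 3.2, p. 35] -/
theorem exists_conj_of_res_comp_iso_id (hG : IsTempered G) (φ ψ : G →ₜ* G)
    (e : Nonempty (BTemp.res (φ.comp ψ) ≅ 𝟭 (BTemp G))) :
    ∃ g : G, ∀ t : G, φ (ψ t) = g⁻¹ * t * g := by
  obtain ⟨e⟩ := e
  -- `𝟭 = B^temp(id)` definitionally
  have η : BTemp.res (φ.comp ψ) ⟶ BTemp.res (ContinuousMonoidHom.id G) := e.hom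
  obtain ⟨g, hg, -⟩ := BTemp.exists_conj_of_natTrans hG (φ.comp ψ) (ContinuousMonoidHom.id G) η
  refine ⟨g, fun t => ?_⟩
  have := hg t
  simp only [ContinuousMonoidHom.comp_toFun, ContinuousMonoidHom.id_toFun] at this
  -- `this : g * φ (ψ t) * g⁻¹ = t`
  calc φ (ψ t) = g⁻¹ * (g * φ (ψ t) * g⁻¹) * g := by group
    _ = g⁻¹ * t * g := by rw [this]

/-- … hence `φ` is surjective. [cite: MochizukiSemiAnbd2006, Prop 3.2, p. 35] -/
theorem surjective_of_res_comp_iso_id (hG : IsTempered G) (φ ψ : G →ₜ* G)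
    (e : Nonempty (BTemp.res (φ.comp ψ) ≅ 𝟭 (BTemp G))) : Function.Surjective φ := by
  obtain ⟨g, hg⟩ := exists_conj_of_res_comp_iso_id hG φ ψ e
  intro s
  refine ⟨ψ (g * s * g⁻¹), ?_⟩
  rw [hg]; group

/-- … and `ψ` is injective. [cite: MochizukiSemiAnbd2006, Prop 3.2, p. 35] -/
theorem injective_of_res_comp_iso_id (hG : IsTempered G) (φ ψ : G →ₜ* G)
    (e : Nonempty (BTemp.res (φ.comp ψ) ≅ 𝟭 (BTemp G))) : Function.Injective ψ := by
  obtain ⟨g, hg⟩ := exists_conj_of_res_comp_iso_id hG φ ψ e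
  intro s t hst
  have h := congrArg φ hst
  rw [hg, hg] at h
  simpa using h

variable {PA : Type w} [Group PA]

omit [IsTopologicalGroup G] in
/-- For a pseudo-action `a ↦ B^temp(φ_a)`, `B^temp(φ_a ∘ φ_{a⁻¹}) ≅ 𝟭`.
[cite: MochizukiSemiAnbd2006, Prop 3.2, p. 35] -/
theorem nonempty_res_comp_inv_iso_id (φ : PA → (G →ₜ* G))
    (hmul : ∀ a b, Nonempty (BTemp.res (φ (a * b)) ≅ BTemp.res (φ a) ⋙ BTemp.res (φ b)))
    (hone : Nonempty (BTemp.res (φ 1) ≅ 𝟭 (BTemp G))) (a : PA) :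
    Nonempty (BTemp.res ((φ a).comp (φ a⁻¹)) ≅ 𝟭 (BTemp G)) := by
  obtain ⟨e⟩ := hmul a a⁻¹
  rw [mul_inv_cancel] at e
  obtain ⟨e1⟩ := hone
  -- `B^temp(φ_a) ⋙ B^temp(φ_{a⁻¹}) = B^temp(φ_a ∘ φ_{a⁻¹})` definitionally
  exact ⟨(e.symm : BTemp.res (φ a) ⋙ BTemp.res (φ a⁻¹) ≅ BTemp.res (φ 1)) ≪≫ e1⟩

/-- **Every `φ_a` of a pseudo-action is bijective**, and `φ_a ∘ φ_{a⁻¹}` is inner.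
[cite: MochizukiSemiAnbd2006, Prop 3.2, p. 35] -/
theorem bijective_of_resFamily (hG : IsTempered G) (φ : PA → (G →ₜ* G))
    (hmul : ∀ a b, Nonempty (BTemp.res (φ (a * b)) ≅ BTemp.res (φ a) ⋙ BTemp.res (φ b)))
    (hone : Nonempty (BTemp.res (φ 1) ≅ 𝟭 (BTemp G))) (a : PA) :
    Function.Bijective (φ a) ∧ ∃ g : G, ∀ t, φ a (φ a⁻¹ t) = g⁻¹ * t * g := by
  have h1 := nonempty_res_comp_inv_iso_id φ hmul hone a
  have h2 := nonempty_res_comp_inv_iso_id φ hmul hone a⁻¹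
  rw [inv_inv] at h2
  exact ⟨⟨injective_of_res_comp_iso_id hG (φ a⁻¹) (φ a) h2,
    surjective_of_res_comp_iso_id hG (φ a) (φ a⁻¹) h1⟩,
    exists_conj_of_res_comp_iso_id hG (φ a) (φ a⁻¹) h1⟩

/-- **Every `φ_a` of a pseudo-action underlies a bi-continuous automorphism** `Φ_a ∈ Aut_top(Π)`
(`EtaleTheta.contMulAut`): the inverse is `φ_{a⁻¹} ∘ conj(g)`, hence continuous.
[cite: MochizukiSemiAnbd2006, Prop 3.2, p. 35] -/
theorem exists_contMulAut_of_resFamily (hG : IsTempered G) (φ : PA → (G →ₜ* G))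
    (hmul : ∀ a b, Nonempty (BTemp.res (φ (a * b)) ≅ BTemp.res (φ a) ⋙ BTemp.res (φ b)))
    (hone : Nonempty (BTemp.res (φ 1) ≅ 𝟭 (BTemp G))) (a : PA) :
    ∃ Φ : contMulAut G, ∀ t, (Φ : MulAut G) t = φ a t := by
  obtain ⟨hbij, g, hg⟩ := bijective_of_resFamily hG φ hmul hone a
  let E : G ≃* G := MulEquiv.ofBijective (φ a).toMonoidHom hbij
  have hE : ∀ t, E t = φ a t := fun _ => rfl
  -- the inverse is `φ_{a⁻¹} ∘ conj(g)`
  have hsymm : ∀ s, E.symm s = φ a⁻¹ (g * s * g⁻¹) := by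
    intro s
    rw [MulEquiv.symm_apply_eq, hE, hg]
    group
  refine ⟨⟨E, ?_, ?_⟩, hE⟩
  · exact (φ a).continuous
  · have : (E.symm : G → G) = fun s => φ a⁻¹ (g * s * g⁻¹) := funext hsymm
    change Continuous (E.symm : G → G)
    rw [this]
    exact (φ a⁻¹).continuous.comp ((continuous_const.mul continuous_id).mul continuous_const)

/-- `B^temp(φ_{ab}) ≅ B^temp(φ_a ∘ φ_b)` forces `φ_a ∘ φ_b = conj(g) ∘ φ_{ab}`.
[cite: MochizukiSemiAnbd2006, Prop 3.2, p. 35] -/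
theorem exists_conj_mul_of_resFamily (hG : IsTempered G) (φ : PA → (G →ₜ* G))
    (hmul : ∀ a b, Nonempty (BTemp.res (φ (a * b)) ≅ BTemp.res (φ a) ⋙ BTemp.res (φ b)))
    (a b : PA) : ∃ g : G, ∀ t, g * φ (a * b) t * g⁻¹ = φ a (φ b t) := by
  obtain ⟨e⟩ := hmul a b
  have η : BTemp.res (φ (a * b)) ⟶ BTemp.res ((φ a).comp (φ b)) := e.hom
  obtain ⟨g, hg, -⟩ := BTemp.exists_conj_of_natTrans hG (φ (a * b)) ((φ a).comp (φ b)) η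
  exact ⟨g, fun t => by simpa using hg t⟩

/-- **A pseudo-action by restriction functors is an outer action** (Prop 3.2 applied to Def 5.1 (i) /
Prop 5.2 (iv)): for a tempered `Π` and continuous endomorphisms `φ_a` (`a ∈ Π_A`) with
`B^temp(φ_{ab}) ≅ B^temp(φ_a) ⋙ B^temp(φ_b)` and `B^temp(φ_1) ≅ 𝟭`, there is a group homomorphism
`ρ : Π_A → Out(Π) = Aut_top(Π)/Inn(Π)` such that each `ρ a` is represented by a bi-continuous
automorphism `Φ_a` agreeing with `φ_a` pointwise. [cite: MochizukiSemiAnbd2006, Prop 3.2, p. 35] -/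
theorem exists_outerAction_of_resFamily (hG : IsTempered G) (φ : PA → (G →ₜ* G))
    (hmul : ∀ a b, Nonempty (BTemp.res (φ (a * b)) ≅ BTemp.res (φ a) ⋙ BTemp.res (φ b)))
    (hone : Nonempty (BTemp.res (φ 1) ≅ 𝟭 (BTemp G))) :
    ∃ ρ : PA →* TopOut G, ∀ a, ∃ Φ : contMulAut G, TopOut.mk G Φ = ρ a ∧
      ∀ t, (Φ : MulAut G) t = φ a t := by
  choose Φ hΦ using exists_contMulAut_of_resFamily hG φ hmul hone
  -- multiplicativity up to inner automorphisms
  have hmul' : ∀ a b, TopOut.mk G (Φ (a * b)) = TopOut.mk G (Φ a) * TopOut.mk G (Φ b) := by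
    intro a b
    obtain ⟨g, hg⟩ := exists_conj_mul_of_resFamily hG φ hmul a b
    -- `Φ a * Φ b = conj g * Φ (ab)` in `Aut_top(Π)`
    let cg : contMulAut G := ⟨MulAut.conj g, innerAut_le_contMulAut G ⟨g, rfl⟩⟩
    have hprod : Φ a * Φ b = cg * Φ (a * b) := by
      apply Subtype.ext
      ext t
      change (Φ a : MulAut G) ((Φ b : MulAut G) t) = g * (Φ (a * b) : MulAut G) t * g⁻¹
      rw [hΦ, hΦ, hΦ, hg]
    have hcg : TopOut.mk G cg = 1 := by
      rw [QuotientGroup.mk'_apply, QuotientGroup.eq_one_iff, Subgroup.mem_subgroupOf]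
      exact ⟨g, rfl⟩
    rw [← map_mul, hprod, map_mul, hcg, one_mul]
  refine ⟨MonoidHom.mk' (fun a => TopOut.mk G (Φ a)) hmul', fun a => ⟨Φ a, rfl, hΦ a⟩⟩

end ResFamily

end Literature.AnabelianGeometry.SemiGraphs
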